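import Mathlib
import Summits.PneNP.PneNP.Theorems.CnfIdealGenLengthRankDefectRepresentationsMergeLowerBound

/-!
# Crux `RankDefectRepresentations` (stmt-PneNP-18923), line `rank-dehn-ladder`, negative rung N0b:
# GRADED almost-representations of `Z_2^n` are quadratically rank-stable (lead g8)

An almost-representation `X_1..X_n` (involutions with `rank [X_i,X_j] ≤ t`) is GRADED if an exact `Z_2^n`-grading
`V = ⊕_{u ⊆ [n]} V_u` with `X_i V_u = V_{u △ {i}}` is given; equivalently it is a `GL_m`-CONNECTION `x` on the cube graph
(`x u i : V_u → V_{u △ {i}}`, the reverse edge carrying the inverse), and `Σ_{u} rank (x_{u△i,j} x_{u,i} − x_{u△j,i} x_{u,j})`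
(the square defects `sqDefect`, each geometric square counted at its four corners) is exactly `rank [X_i, X_j]`.  Induced local
systems, covering-space / monomial / signed-permutation almost-actions and (after a Hadamard transform) the translation-invariant
two-step extensions all belong to this class (`Lines/rank-dehn-ladder-g8.md` §4, §6, §7).

**Theorem (`graded_stability`).**  For every such connection there are a base vertex `b` and an everywhere-invertible gauge
`G : 2^{[n]} → GL_m` such that the flat connection `u ↦ G(u △ {i}) G(u)^{-1}` differs from `x` in total rank (summed over all
edges, one orientation each) by at most `¼ · Σ_{u, i<j} sqDefect = ¼ · Σ_{i<j} rank [X_i,X_j] ≤ n(n−1)t/8`; in particular graded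
almost-representations are within rank `n(n−1)t/4` (both edge orientations) of genuine ones — POLYNOMIAL stability, in every
characteristic, for the class that carries every induced / permutation construction of the line.
Proof: for the base vertex `b` take the spanning tree "parent = remove the largest element of `u △ b`" and the gauge `G` = transport
along tree paths (`gauge`); the discrepancy on a non-tree edge is the holonomy of its fundamental cycle, which bounds a LADDER of squares,
so `rank ≤ Σ_{ladder} sqDefect` (`rank_gauge_sub_le`, induction on the largest element); every square lies on ladders with average
multiplicity exactly one over the `2^n` base vertices (`sum_base_bound_eq`), so some base vertex achieves the average (`graded_stability`).
HONEST FRAMING: elementary; P ≠ NP is not moved; F-N2 is a FRONTIER formal rung; `stub_uniformStability` (ungraded) stays open.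
-/

set_option linter.dupNamespace false -- `Summit.PneNP.PneNP.…`: summit = sub-problem name (D-0017)

namespace Summit.PneNP.PneNP.Theorems.CnfIdealGenLengthRankDefectRepresentationsGradedStability

open Finset Matrix Module
open scoped symmDiff

variable {K : Type} [Field K] {n m : ℕ}

/-- A cube vertex is a subset of the coordinates; `Vert n = Finset (Fin n)`. -/
abbrev Vert (n : ℕ) : Type := Finset (Fin n)

open Summit.PneNP.PneNP.Theorems.CnfIdealGenLengthRankDefectRepresentationsMergeLowerBound (rank_add_le' rank_sum_le')

section Gauge

variable (x : Vert n → Fin n → Matrix (Fin m) (Fin m) K)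

/-- The SQUARE DEFECT at corner `u` in directions `i, j`: rank of the difference of the two two-step transports
`u → u△{i} → u△{i,j}` and `u → u△{j} → u△{i,j}` (equals `rank (holonomy − 1)` when the blocks are invertible). -/
noncomputable def sqDefect (u : Vert n) (i j : Fin n) : ℕ :=
  (x (u ∆ {i}) j * x u i - x (u ∆ {j}) i * x u j).rank

/-- The tree GAUGE for the base vertex `∅`: transport along the path that inserts the elements of `u` in increasing
order (defined by peeling off the largest element). -/
noncomputable def gauge : Vert n → Matrix (Fin m) (Fin m) K
  | u => if h : u.Nonempty then x (u.erase (u.max' h)) (u.max' h) * gauge (u.erase (u.max' h)) else 1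
  termination_by u => u.card
  decreasing_by exact Finset.card_erase_lt_of_mem (Finset.max'_mem _ _)

/-- The gauge at the base vertex is the identity. -/
theorem gauge_empty : gauge x ∅ = 1 := by
  rw [gauge]; simp

/-- Unfolding the gauge at a vertex whose largest element is `h`. -/
theorem gauge_insert_of_lt (s : Vert n) (h : Fin n) (hs : ∀ y ∈ s, y < h) :
    gauge x (insert h s) = x s h * gauge x s := by
  have hne : (insert h s).Nonempty := ⟨h, Finset.mem_insert_self _ _⟩
  have hmax : (insert h s).max' hne = h := by
    apply le_antisymm
    · apply Finset.max'_le; intro y hy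
      rcases Finset.mem_insert.mp hy with rfl | hy
      · exact le_rfl
      · exact (hs y hy).le
    · exact Finset.le_max' _ _ (Finset.mem_insert_self _ _)
  have hnot : h ∉ s := fun hh => lt_irrefl _ (hs h hh)
  rw [gauge, dif_pos hne, hmax, Finset.erase_insert hnot]

/-- For `i ∉ u`, `u △ {i} = insert i u`. -/
theorem symmDiff_singleton_eq_insert {u : Vert n} {i : Fin n} (hi : i ∉ u) : u ∆ {i} = insert i u := by
  ext y
  simp only [Finset.mem_symmDiff, Finset.mem_singleton, Finset.mem_insert]
  constructor
  · rintro (⟨hy, -⟩ | ⟨rfl, -⟩)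
    · exact Or.inr hy
    · exact Or.inl rfl
  · rintro (rfl | hy)
    · exact Or.inr ⟨rfl, hi⟩
    · exact Or.inl ⟨hy, fun h => hi (h ▸ hy)⟩

/-- **Ladder bound.**  For `i ∉ v`, the tree gauge transported across the edge `(v, v ∪ {i})` differs from the connection by at
most the sum of the square defects along the ladder `{(v ∩ [0,j)) ; i, j) : j ∈ v, i < j}`. -/
theorem rank_gauge_sub_le (v : Vert n) (i : Fin n) (hi : i ∉ v) :
    (gauge x (insert i v) - x v i * gauge x v).rank ≤
      ∑ j ∈ v.filter (fun j => i < j), sqDefect x (v.filter (fun y => y < j)) i j := by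
  classical
  induction v using Finset.induction_on_max generalizing i with
  | empty =>
      rw [gauge_insert_of_lt x ∅ i (by simp), gauge_empty]
      simp
  | insert h s hlt ih =>
      have hih : i ≠ h := fun e => hi (e ▸ Finset.mem_insert_self _ _)
      have his : i ∉ s := fun e => hi (Finset.mem_insert_of_mem e)
      have hnot : h ∉ s := fun hh => lt_irrefl _ (hlt h hh)
      rcases lt_or_gt_of_ne hih with hlt' | hgt
      · -- `i < h`: the largest element of `insert i (insert h s)` is `h`; peel it.
        have e1 : insert i (insert h s) = insert h (insert i s) := Finset.insert_comm _ _ _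
        have hs' : ∀ y ∈ insert i s, y < h := by
          intro y hy; rcases Finset.mem_insert.mp hy with rfl | hy
          · exact hlt'
          · exact hlt y hy
        rw [e1, gauge_insert_of_lt x (insert i s) h hs', gauge_insert_of_lt x s h hlt]
        have halg : x (insert i s) h * gauge x (insert i s) - x (insert h s) i * (x s h * gauge x s)
            = x (insert i s) h * (gauge x (insert i s) - x s i * gauge x s)
              + (x (insert i s) h * x s i - x (insert h s) i * x s h) * gauge x s := by
          simp only [mul_sub, sub_mul, Matrix.mul_assoc]; abel
        rw [halg]
        have hsq : (x (insert i s) h * x s i - x (insert h s) i * x s h) = 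
            (x (s ∆ {i}) h * x s i - x (s ∆ {h}) i * x s h) := by
          rw [symmDiff_singleton_eq_insert his, symmDiff_singleton_eq_insert hnot]
        have hfilt : (insert h s).filter (fun j => i < j) = insert h (s.filter fun j => i < j) := by
          rw [Finset.filter_insert, if_pos hlt']
        have hnot' : h ∉ s.filter (fun j => i < j) := fun e => hnot (Finset.mem_filter.mp e).1
        rw [hfilt, Finset.sum_insert hnot']
        have hbelow_h : (insert h s).filter (fun y => y < h) = s := by
          ext y; simp only [Finset.mem_filter, Finset.mem_insert]
          constructor
          · rintro ⟨rfl | hy, hy'⟩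
            · exact absurd hy' (lt_irrefl _)
            · exact hy
          · intro hy; exact ⟨Or.inr hy, hlt y hy⟩
        have hbelow_j : ∀ j ∈ s.filter (fun j => i < j),
            (insert h s).filter (fun y => y < j) = s.filter (fun y => y < j) := by
          intro j hj
          have hjs : j ∈ s := (Finset.mem_filter.mp hj).1
          rw [Finset.filter_insert, if_neg (not_lt.mpr (hlt j hjs).le)]
        rw [hbelow_h, Finset.sum_congr rfl fun j hj => by rw [hbelow_j j hj]]
        calc (x (insert i s) h * (gauge x (insert i s) - x s i * gauge x s)
                + (x (insert i s) h * x s i - x (insert h s) i * x s h) * gauge x s).rank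
            ≤ (x (insert i s) h * (gauge x (insert i s) - x s i * gauge x s)).rank
                + ((x (insert i s) h * x s i - x (insert h s) i * x s h) * gauge x s).rank := rank_add_le' _ _
          _ ≤ (gauge x (insert i s) - x s i * gauge x s).rank
                + (x (insert i s) h * x s i - x (insert h s) i * x s h).rank :=
              Nat.add_le_add (Matrix.rank_mul_le_right _ _) (Matrix.rank_mul_le_left _ _)
          _ ≤ (∑ j ∈ s.filter (fun j => i < j), sqDefect x (s.filter (fun y => y < j)) i j) + sqDefect x s i h := by
              apply Nat.add_le_add (ih i his)
              rw [hsq]; exact le_rfl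
          _ = sqDefect x s i h + ∑ j ∈ s.filter (fun j => i < j), sqDefect x (s.filter (fun y => y < j)) i j :=
              Nat.add_comm _ _
      · -- `h < i`: then `i` is the largest element, the edge is a TREE edge and the discrepancy vanishes.
        have hs' : ∀ y ∈ insert h s, y < i := by
          intro y hy; rcases Finset.mem_insert.mp hy with rfl | hy
          · exact hgt
          · exact (hlt y hy).trans hgt
        rw [gauge_insert_of_lt x (insert h s) i hs', sub_self, Matrix.rank_zero]
        exact Nat.zero_le _

/-- If all blocks are invertible on the left, every gauge value is a unit. -/
theorem isUnit_gauge (hx : ∀ u i, IsUnit (x u i)) (u : Vert n) : IsUnit (gauge x u) := by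
  classical
  induction u using Finset.induction_on_max with
  | empty => rw [gauge_empty]; exact isUnit_one
  | insert h s hlt ih => rw [gauge_insert_of_lt x s h hlt]; exact (hx s h).mul ih

end Gauge

section Averaging

variable (x : Vert n → Fin n → Matrix (Fin m) (Fin m) K)

/-- The connection seen from the base vertex `b`: `x^b u i := x (u △ b) i`. -/
def shift (b : Vert n) : Vert n → Fin n → Matrix (Fin m) (Fin m) K := fun u i => x (u ∆ b) i

/-- Square defects of the shifted connection are the shifted square defects. -/
theorem sqDefect_shift (b u : Vert n) (i j : Fin n) :
    sqDefect (shift x b) u i j = sqDefect x (u ∆ b) i j := by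
  simp only [sqDefect, shift, symmDiff_right_comm]

/-- The total ladder bound for the base vertex `b`: `Σ_{v, i ∉ v} Σ_{j ∈ v, i<j} sqDefect x^b (v ∩ [0,j)) i j`. -/
noncomputable def baseBound (b : Vert n) : ℕ :=
  ∑ v : Vert n, ∑ i ∈ (Finset.univ : Finset (Fin n)).filter (fun i => i ∉ v),
    ∑ j ∈ v.filter (fun j => i < j), sqDefect x ((v.filter fun y => y < j) ∆ b) i j

/-- The total square defect `D := Σ_{u} Σ_{i<j} sqDefect x u i j` (each geometric square counted at its four corners; for a
graded almost-representation this is `Σ_{i<j} rank [X_i, X_j]`). -/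
noncomputable def totalDefect : ℕ :=
  ∑ u : Vert n, ∑ i : Fin n, ∑ j ∈ (Finset.univ : Finset (Fin n)).filter (fun j => i < j), sqDefect x u i j

/-- **Average multiplicity one.**  Summed over all `2^n` base vertices, the ladder bounds add up to exactly `2^{n-2} · D`
(`2^{n-2}` read with truncated subtraction): every square lies on ladders with average multiplicity one. -/
theorem sum_baseBound_eq :
    ∑ b : Vert n, baseBound x b = 2 ^ (n - 2) * totalDefect x := by
  classical
  have key : ∀ (i j : Fin n), i < j →
      ∑ b : Vert n, ∑ v ∈ (Finset.univ : Finset (Vert n)).filter (fun v => i ∉ v ∧ j ∈ v),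
        sqDefect x ((v.filter fun y => y < j) ∆ b) i j
        = 2 ^ (n - 2) * ∑ u : Vert n, sqDefect x u i j := by
    intro i j hij
    have inner : ∀ v : Vert n, ∑ b : Vert n, sqDefect x ((v.filter fun y => y < j) ∆ b) i j
        = ∑ u : Vert n, sqDefect x u i j := by
      intro v
      exact Finset.sum_bij (fun b _ => (v.filter fun y => y < j) ∆ b) (by simp) 
        (by intro b₁ _ b₂ _ h; simpa [symmDiff_right_inj] using h)
        (by intro u _; exact ⟨(v.filter fun y => y < j) ∆ u, by simp, by simp⟩)
        (by intro b _; rfl)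
    rw [Finset.sum_comm]
    simp_rw [inner]
    rw [Finset.sum_const, smul_eq_mul]
    congr 1
    have hcount : ((Finset.univ : Finset (Vert n)).filter (fun v => i ∉ v ∧ j ∈ v)).card = 2 ^ (n - 2) := by
      have : ((Finset.univ : Finset (Vert n)).filter (fun v => i ∉ v ∧ j ∈ v))
          = ((Finset.univ.erase i).erase j).powerset.image (fun w => insert j w) := by
        ext v
        simp only [Finset.mem_filter, Finset.mem_univ, true_and, Finset.mem_image, Finset.mem_powerset]
        constructor
        · rintro ⟨hiv, hjv⟩
          refine ⟨v.erase j, ?_, Finset.insert_erase hjv⟩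
          intro y hy
          rw [Finset.mem_erase] at hy
          rw [Finset.mem_erase, Finset.mem_erase]
          exact ⟨hy.1, fun h => hiv (h ▸ hy.2), Finset.mem_univ _⟩
        · rintro ⟨w, hw, rfl⟩
          refine ⟨fun h => ?_, Finset.mem_insert_self _ _⟩
          rcases Finset.mem_insert.mp h with h | h
          · exact absurd h (ne_of_lt hij)
          · have := hw h; rw [Finset.mem_erase, Finset.mem_erase] at this; exact this.2.1 rfl
      have hinj : Set.InjOn (fun w : Vert n => insert j w) ↑(((Finset.univ.erase i).erase j).powerset) := by
        intro w₁ hw₁ w₂ hw₂ h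
        have hw₁' := Finset.mem_powerset.mp (Finset.mem_coe.mp hw₁)
        have hw₂' := Finset.mem_powerset.mp (Finset.mem_coe.mp hw₂)
        have hj1 : j ∉ w₁ := fun hj => by
          have := hw₁' hj; rw [Finset.mem_erase] at this; exact this.1 rfl
        have hj2 : j ∉ w₂ := fun hj => by
          have := hw₂' hj; rw [Finset.mem_erase] at this; exact this.1 rfl
        have := congrArg (fun s => Finset.erase s j) h
        simpa [Finset.erase_insert hj1, Finset.erase_insert hj2] using this
      have hmem : j ∈ Finset.univ.erase i := by
        rw [Finset.mem_erase]; exact ⟨ne_of_gt hij, Finset.mem_univ _⟩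
      rw [this, Finset.card_image_of_injOn hinj, Finset.card_powerset, Finset.card_erase_of_mem hmem,
        Finset.card_erase_of_mem (Finset.mem_univ _), Finset.card_univ, Fintype.card_fin]
      congr 1
    rw [hcount]
  unfold baseBound totalDefect
  have lhs : ∀ b : Vert n, (∑ v : Vert n, ∑ i ∈ (Finset.univ : Finset (Fin n)).filter (fun i => i ∉ v),
      ∑ j ∈ v.filter (fun j => i < j), sqDefect x ((v.filter fun y => y < j) ∆ b) i j)
      = ∑ i : Fin n, ∑ j ∈ (Finset.univ : Finset (Fin n)).filter (fun j => i < j),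
          ∑ v ∈ (Finset.univ : Finset (Vert n)).filter (fun v => i ∉ v ∧ j ∈ v),
            sqDefect x ((v.filter fun y => y < j) ∆ b) i j := by
    intro b
    rw [Finset.sum_comm' (t' := Finset.univ) (s' := fun i => (Finset.univ : Finset (Vert n)).filter (fun v => i ∉ v))
      (by intro v i; simp)]
    refine Finset.sum_congr rfl fun i _ => ?_
    rw [Finset.sum_comm' (t' := (Finset.univ : Finset (Fin n)).filter (fun j => i < j))
      (s' := fun j => (Finset.univ : Finset (Vert n)).filter (fun v => i ∉ v ∧ j ∈ v))
      (by intro v j; simp [and_comm, and_left_comm])]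
  simp_rw [lhs]
  have rhs : (∑ u : Vert n, ∑ i : Fin n, ∑ j ∈ (Finset.univ : Finset (Fin n)).filter (fun j => i < j),
      sqDefect x u i j) = ∑ i : Fin n, ∑ j ∈ (Finset.univ : Finset (Fin n)).filter (fun j => i < j),
        ∑ u : Vert n, sqDefect x u i j := by
    rw [Finset.sum_comm]
    refine Finset.sum_congr rfl fun i _ => ?_
    rw [Finset.sum_comm]
  rw [rhs, Finset.mul_sum]
  rw [Finset.sum_comm]
  refine Finset.sum_congr rfl fun i _ => ?_
  rw [Finset.sum_comm, Finset.mul_sum]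
  refine Finset.sum_congr rfl fun j hj => ?_
  exact key i j (Finset.mem_filter.mp hj).2

/-- Some base vertex achieves the average: `4 · baseBound x b ≤ D`. -/
theorem exists_base (hn : 2 ≤ n) : ∃ b : Vert n, 4 * baseBound x b ≤ totalDefect x := by
  classical
  have hsum := sum_baseBound_eq x
  obtain ⟨b, -, hb⟩ := Finset.exists_le_of_sum_le (s := (Finset.univ : Finset (Vert n))) Finset.univ_nonempty
    (f := fun b => 4 * baseBound x b) (g := fun _ => totalDefect x) (by
      rw [← Finset.mul_sum, hsum, Finset.sum_const, Finset.card_univ, smul_eq_mul, ← mul_assoc]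
      have : Fintype.card (Vert n) = 4 * 2 ^ (n - 2) := by
        rw [Fintype.card_finset, Fintype.card_fin]
        obtain ⟨k, rfl⟩ := Nat.exists_eq_add_of_le hn
        rw [Nat.add_sub_cancel_left, pow_add]; norm_num
      rw [this])
  exact ⟨b, hb⟩

end Averaging


section PureGauge

variable (G : Vert n → Matrix (Fin m) (Fin m) K)

/-- The PURE GAUGE (flat) connection of a gauge `G`: transport `u → u △ {i}` by `G(u △ {i}) · G(u)⁻¹`. -/
noncomputable def pureGauge (u : Vert n) (i : Fin n) : Matrix (Fin m) (Fin m) K := G (u ∆ {i}) * (G u)⁻¹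

variable {G}

/-- `G(u)⁻¹ G(u) = 1` for an everywhere-invertible gauge. -/
theorem inv_mul_of_isUnit (hG : ∀ u, IsUnit (G u)) (u : Vert n) : (G u)⁻¹ * G u = 1 :=
  Matrix.nonsing_inv_mul _ ((Matrix.isUnit_iff_isUnit_det _).mp (hG u))

/-- A pure gauge connection is FLAT: the two two-step transports around every square agree (so the square defects vanish and
the associated graded representation is genuine: the `X′_i` commute). -/
theorem pureGauge_flat (hG : ∀ u, IsUnit (G u)) (u : Vert n) (i j : Fin n) :
    pureGauge G (u ∆ {i}) j * pureGauge G u i = pureGauge G (u ∆ {j}) i * pureGauge G u j := by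
  simp only [pureGauge, Matrix.mul_assoc]
  rw [← Matrix.mul_assoc (G (u ∆ {i}))⁻¹, inv_mul_of_isUnit hG, Matrix.one_mul,
    ← Matrix.mul_assoc (G (u ∆ {j}))⁻¹, inv_mul_of_isUnit hG, Matrix.one_mul, symmDiff_right_comm]

/-- A pure gauge connection is INVOLUTIVE: going back along an edge inverts (so the `X′_i` are involutions). -/
theorem pureGauge_back (hG : ∀ u, IsUnit (G u)) (u : Vert n) (i : Fin n) :
    pureGauge G (u ∆ {i}) i * pureGauge G u i = 1 := by
  simp only [pureGauge, Matrix.mul_assoc]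
  rw [← Matrix.mul_assoc (G (u ∆ {i}))⁻¹, inv_mul_of_isUnit hG, Matrix.one_mul, symmDiff_assoc, symmDiff_self,
    symmDiff_bot]
  exact Matrix.mul_nonsing_inv _ ((Matrix.isUnit_iff_isUnit_det _).mp (hG u))

/-- The square defects of a pure gauge connection vanish. -/
theorem sqDefect_pureGauge (hG : ∀ u, IsUnit (G u)) (u : Vert n) (i j : Fin n) :
    sqDefect (pureGauge G) u i j = 0 := by
  rw [sqDefect, pureGauge_flat hG, sub_self, Matrix.rank_zero]

end PureGauge

section Main

variable (x : Vert n → Fin n → Matrix (Fin m) (Fin m) K)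

/-- **GRADED STABILITY (connection form).**  For every `GL_m`-connection `x` on the `n`-cube graph (`n ≥ 2`) there are a base
vertex `b` and a gauge `G` (transport along the `b`-rooted tree; everywhere invertible as soon as the blocks of `x` are) such
that, summing over all edges `(u, u △ {i})` oriented away from `b` in coordinate `i` (i.e. `i ∈ u ↔ i ∈ b`), the flat connection
`G(u △ {i}) · G(u)^{-1}` differs from `x` in total rank by at most a quarter of the total square defect:
`4 · Σ rank (G (u △ {i}) − x u i · G u) ≤ Σ_{c, i<j} sqDefect x c i j` (`= Σ_{i<j} rank [X_i,X_j]` for the graded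
almost-representation).  Hence graded almost-representations are within rank `n(n−1)t/4` of genuine ones. -/
theorem graded_stability (hn : 2 ≤ n) :
    ∃ (b : Vert n) (G : Vert n → Matrix (Fin m) (Fin m) K),
      ((∀ u i, IsUnit (x u i)) → ∀ u, IsUnit (G u)) ∧
      4 * ∑ v : Vert n, ∑ i ∈ (Finset.univ : Finset (Fin n)).filter (fun i => i ∉ v),
          (G ((insert i v) ∆ b) - x (v ∆ b) i * G (v ∆ b)).rank ≤ totalDefect x := by
  classical
  obtain ⟨b, hb⟩ := exists_base x hn
  refine ⟨b, fun u => gauge (shift x b) (u ∆ b), ?_, ?_⟩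
  · intro hx u
    exact isUnit_gauge (shift x b) (fun u i => hx _ _) _
  · refine le_trans (Nat.mul_le_mul_left 4 ?_) hb
    unfold baseBound
    refine Finset.sum_le_sum fun v _ => Finset.sum_le_sum fun i hi => ?_
    have hiv : i ∉ v := (Finset.mem_filter.mp hi).2
    have h1 : (insert i v) ∆ b ∆ b = insert i v := by rw [symmDiff_assoc, symmDiff_self, symmDiff_bot]
    have h2 : v ∆ b ∆ b = v := by rw [symmDiff_assoc, symmDiff_self, symmDiff_bot]
    dsimp only
    rw [h1, h2]
    have := rank_gauge_sub_le (shift x b) v i hiv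
    simp only [sqDefect_shift] at this
    simpa [shift] using this

/-- **GRADED STABILITY (flat-connection form).**  If the blocks of `x` are invertible, there are a base vertex `b` and an
everywhere-invertible gauge `G` whose pure gauge connection `x′ = pureGauge G` — a FLAT, involutive connection, i.e. a genuine
graded representation (`pureGauge_flat`, `pureGauge_back`) — satisfies
`4 · Σ_{edges} rank (x′_e − x_e) ≤ Σ_{c, i<j} sqDefect x c i j`, the sum running over all edges oriented by `b`
(`e = (v △ b → v △ b △ {i})`, `i ∉ v`, each geometric edge once). -/
theorem graded_stability_flat (hn : 2 ≤ n) (hx : ∀ u i, IsUnit (x u i)) :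
    ∃ (b : Vert n) (G : Vert n → Matrix (Fin m) (Fin m) K), (∀ u, IsUnit (G u)) ∧
      4 * ∑ v : Vert n, ∑ i ∈ (Finset.univ : Finset (Fin n)).filter (fun i => i ∉ v),
          (pureGauge G (v ∆ b) i - x (v ∆ b) i).rank ≤ totalDefect x := by
  classical
  obtain ⟨b, G, hG, hbound⟩ := graded_stability x hn
  have hG' := hG hx
  refine ⟨b, G, hG', le_trans (le_of_eq ?_) hbound⟩
  congr 1
  refine Finset.sum_congr rfl fun v _ => Finset.sum_congr rfl fun i hi => ?_
  have hiv : i ∉ v := (Finset.mem_filter.mp hi).2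
  have hdet : IsUnit (G (v ∆ b)).det := (Matrix.isUnit_iff_isUnit_det _).mp (hG' _)
  have e1 : insert i v ∆ b = (v ∆ b) ∆ {i} := by
    rw [← symmDiff_singleton_eq_insert hiv, symmDiff_right_comm]
  have e2 : pureGauge G (v ∆ b) i - x (v ∆ b) i
      = (G (insert i v ∆ b) - x (v ∆ b) i * G (v ∆ b)) * (G (v ∆ b))⁻¹ := by
    rw [sub_mul, Matrix.mul_assoc, Matrix.mul_nonsing_inv _ hdet, Matrix.mul_one, pureGauge, e1]
  rw [e2, Matrix.rank_mul_eq_left_of_isUnit_det]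
  rw [Matrix.det_nonsing_inv]
  exact hdet.ringInverse

end Main

end Summit.PneNP.PneNP.Theorems.CnfIdealGenLengthRankDefectRepresentationsGradedStability
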